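/-
Copyright (c) 2026 the pub-hodgecm-mathlib formalisation cell (harness21).  Prover seat hodgecm-mathlib-K2E5-p16 (g7), Track B «K2-LIT»,
#184♮ = hLiu418 = `stmt-HodgeConjecture-24832`; #42S organ S2, TRANSPORT row, FILE 7 `K2LiuArchReadingFrameKdiag` (S2 desk K2Liu-p05 (g6) 15:42:01Z (b):
«`fr_mem_kV_range` — the frame compacts live in `K_diag`, for the wrapper (K2Liu-p23) ∕ B2 (K2Liu-p27)»).  THEOREMS ONLY (no `def`, no `instance`, no notation,
no named-fact hypothesis, no `sorry`).
-/
import Summits.HodgeConjecture.HodgeConjecture.Theorems.K2LiuArchReadingFrameSign   -- ★ FILE 3 p861222: `exists_kV_readingPoint`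
import HarnessLib

/-!
# Crux `HLiu418`, organ S2, FILE 7: the reading frames live in the diagonal frame compact `K_diag = ∏_σ kV(U(𝔻⁺_σ) × U(𝔻⁻_σ))`

Cell `hodgecm-mathlib`, crux item hLiu418 = `stmt-HodgeConjecture-24832` (helper lane `--supports`, count-neutral).  ★ FILE 3's SIGN LETTER
`exists_kV_readingPoint` read as MEMBERSHIP: for reading frames `fr_w` with ★ FILE 2's matrix formula, every sign-frame component of a reading point is in the
range of Konno–Konno's `kV`:
* `mulSingle_frameHom` — `Pi.mulSingle w (fr_w u) = (w′ ↦ fr_{w′} ((Pi.mulSingle w u) w′))` (a family of homomorphisms);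
* **`fr_tuple_mem_kV_range`** — `archUFormPi_𝔻 (archPiEquivCM⁻¹ (w ↦ fr_w (v w))) σ ∈ (kV 𝔻⁺_σ 𝔻⁻_σ).range` for every tuple `v` and every real place `σ`;
* **`fr_mem_kV_range`** — the single-slot case `archUFormPi_𝔻 (archPiEquivCM⁻¹ (Pi.mulSingle w (fr_w u))) σ ∈ (kV 𝔻⁺_σ 𝔻⁻_σ).range` (desk (b) VERBATIM): the
  letter `hk1(𝒦₀)` of the transport wrapper `K2LiuArchSWSpanningConjTransport` in B2's currency «the frame compacts live in `K_diag`».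
References: [KonnoKonno2007, §3.1 (3.1)]; [Folland1989, §4.2 Prop. (4.39)]; [Shimura1997, §6.5].
HONEST LABEL: HC_CM is proved only modulo the 7 printed citations (2 remaining named inputs: hLiu418 = stmt-HodgeConjecture-24832,
h413 = stmt-HodgeConjecture-24833) until rung 0 closes; count-neutral helper, closes no socket.
-/

set_option autoImplicit false
set_option linter.dupNamespace false

noncomputable section

namespace Summit.HodgeConjecture.HodgeConjecture.Cruxes.HLiu418.K2LiuArchReadingFrameKdiag

open Matrix Complex NumberField NumberField.InfinitePlace
open scoped MatrixGroups ComplexConjugate Classical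
open Literature.NumberTheory.Automorphic Literature.NumberTheory.Automorphic.UnitaryGroup Literature.NumberTheory.Weil1964
open Literature.NumberTheory.GelbartRogawski1991 Literature.NumberTheory.GelbartRogawski1991.UnitaryDualPair
open Literature.NumberTheory.GelbartRogawski1991.GRConstruction
open Literature.RepresentationTheory.KonnoKonno2007 Literature.RepresentationTheory.KonnoKonno2007.RealDualPair

/-- a single slot of a family of homomorphisms: `Pi.mulSingle w (f_w u) = (w′ ↦ f_{w′} ((Pi.mulSingle w u) w′))`. [folklore] -/
theorem mulSingle_frameHom {ι : Type*} [DecidableEq ι] {A : ι → Type*} {B : ι → Type*} [∀ i, Monoid (A i)] [∀ i, Monoid (B i)]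
    (f : ∀ i, A i →* B i) (i : ι) (u : A i) : Pi.mulSingle i (f i u) = fun j => f j (Pi.mulSingle i u j) := by
  funext j
  by_cases h : j = i
  · subst h
    rw [Pi.mulSingle_eq_same, Pi.mulSingle_eq_same]
  · rw [Pi.mulSingle_eq_of_ne h, Pi.mulSingle_eq_of_ne h, map_one]

variable (L : Type) [Field L] [NumberField L] [IsCMField L] {N M n : ℕ} (e : Fin N × Fin M ≃ Fin n)
  (dV : Fin N → L) (hdV : ∀ i, IsCMField.complexConj L (dV i) = dV i)
  (dW : Fin M → L) (hdW : ∀ i, IsCMField.complexConj L (dW i) = dW i)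

/-- **THE READING POINTS LIVE IN `K_diag`**: for reading frames with ★ FILE 2's matrix formula, every tuple `v` and every real place `σ`,
`archUFormPi_𝔻 (archPiEquivCM⁻¹ (w ↦ fr_w (v w))) σ ∈ (kV 𝔻⁺_σ 𝔻⁻_σ).range` (★ FILE 3 `exists_kV_readingPoint`, determinant clauses dropped).
[cite: KonnoKonno2007, §3.1 (3.1)] [cite: Folland1989, §4.2 Prop. (4.39)] [cite: Shimura1997, §6.5] -/
theorem fr_tuple_mem_kV_range (hdV0 : ∀ i, dV i ≠ 0) (hdW0 : ∀ j, dW j ≠ 0)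
    (fr : ∀ w : {w : InfinitePlace L // w.IsComplex}, Matrix.unitaryGroup (Fin n) ℂ →* archLocal L (n + n) (hermD L e dV hdV dW hdW) w)
    (hfrM : ∀ (w : {w : InfinitePlace L // w.IsComplex}) (u : Matrix.unitaryGroup (Fin n) ℂ),
      ((((fr w u : archLocal L (n + n) (hermD L e dV hdV dW hdW) w) : GL (Fin (n + n)) ℂ)) : Matrix (Fin (n + n)) (Fin (n + n)) ℂ) =
        Matrix.reindex (e₂ (n := n)) (e₂ (n := n))
          (fromBlocks (diagonal (fun k => (((Real.sqrt (|(w.1.embedding (dV (e.symm k).1 * dW (e.symm k).2)).re| / 2))⁻¹ / 2 : ℝ) : ℂ)))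
              (-diagonal (fun k => I * (((Real.sqrt (|(w.1.embedding (dV (e.symm k).1 * dW (e.symm k).2)).re| / 2))⁻¹ *
                ((w.1.embedding (dV (e.symm k).1 * dW (e.symm k).2)).re / |(w.1.embedding (dV (e.symm k).1 * dW (e.symm k).2)).re|) / 2 : ℝ) : ℂ)))
              (diagonal (fun k => (((Real.sqrt (|(w.1.embedding (dV (e.symm k).1 * dW (e.symm k).2)).re| / 2))⁻¹ / 2 : ℝ) : ℂ)))
              (diagonal (fun k => I * (((Real.sqrt (|(w.1.embedding (dV (e.symm k).1 * dW (e.symm k).2)).re| / 2))⁻¹ *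
                ((w.1.embedding (dV (e.symm k).1 * dW (e.symm k).2)).re / |(w.1.embedding (dV (e.symm k).1 * dW (e.symm k).2)).re|) / 2 : ℝ) : ℂ))) *
            ((fromBlocks 1 1 (I • 1) (-(I • 1)) : Matrix (Fin n ⊕ Fin n) (Fin n ⊕ Fin n) ℂ) * fromBlocks 1 0 0 (u : Matrix (Fin n) (Fin n) ℂ) *
              ((2 : ℂ)⁻¹ • fromBlocks 1 (-(I • 1)) 1 (I • 1))) *
            fromBlocks (diagonal (fun k => (Real.sqrt (|(w.1.embedding (dV (e.symm k).1 * dW (e.symm k).2)).re| / 2) : ℂ)))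
              (diagonal (fun k => (Real.sqrt (|(w.1.embedding (dV (e.symm k).1 * dW (e.symm k).2)).re| / 2) : ℂ)))
              (diagonal (fun k => I * ((((w.1.embedding (dV (e.symm k).1 * dW (e.symm k).2)).re / |(w.1.embedding (dV (e.symm k).1 * dW (e.symm k).2)).re|) *
                Real.sqrt (|(w.1.embedding (dV (e.symm k).1 * dW (e.symm k).2)).re| / 2) : ℝ) : ℂ)))
              (-diagonal (fun k => I * ((((w.1.embedding (dV (e.symm k).1 * dW (e.symm k).2)).re / |(w.1.embedding (dV (e.symm k).1 * dW (e.symm k).2)).re|) *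
                Real.sqrt (|(w.1.embedding (dV (e.symm k).1 * dW (e.symm k).2)).re| / 2) : ℝ) : ℂ)))))
    (v : {w : InfinitePlace L // w.IsComplex} → Matrix.unitaryGroup (Fin n) ℂ) (σ : {v : InfinitePlace (Fp L) // v.IsReal}) :
    archUFormPi L (IsCMField.complexConj L) (n + n) (IsCMField.complexConj_ne_one L) (cmPlaceOver L) (cmPlaceOver_smul L) (cmPlaceOver_comap L) _
          (gramD_gram_realDiagonal_entry_ne_zero L e dV hdV dW hdW hdV0 hdW0) (gramD_eq_diagonal_cm L e dV hdV dW hdW) (J := hermD L e dV hdV dW hdW) rfl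
          (complexConj_imagUnit L) (imagUnit_ne_zero L)
          ((archPiEquivCM (n + n) L (hermD L e dV hdV dW hdW)).symm fun w => fr w (v w)) σ ∈
      (UForm.kV (PosIdx (signVec (cmPlaceOver L)
        (fun k => Sum.elim (cmGramEntry L e dV hdV dW hdW) (-cmGramEntry L e dV hdV dW hdW) ((UnitaryDualPair.LocalSplitting.e₂ n).symm k)) (imagUnit L) σ))
        (NegIdx (signVec (cmPlaceOver L)
        (fun k => Sum.elim (cmGramEntry L e dV hdV dW hdW) (-cmGramEntry L e dV hdV dW hdW) ((UnitaryDualPair.LocalSplitting.e₂ n).symm k)) (imagUnit L) σ))).range := by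
  obtain ⟨k, hk, -, -⟩ := K2LiuArchReadingFrameSign.exists_kV_readingPoint L e dV hdV dW hdW hdV0 hdW0 fr hfrM v σ
  exact ⟨k, hk.symm⟩

/-- **`fr_mem_kV_range` (desk (b) VERBATIM) — THE FRAME COMPACTS LIVE IN `K_diag`**: for every complex place `w`, every `u ∈ U(n)` and every real place `σ`,
`archUFormPi_𝔻 (archPiEquivCM⁻¹ (Pi.mulSingle w (fr_w u))) σ ∈ (kV 𝔻⁺_σ 𝔻⁻_σ).range` — the single-slot tuple `Pi.mulSingle w u` in `fr_tuple_mem_kV_range`; this is the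
letter `hk1(𝒦₀)` of the transport wrapper in B2's currency. [cite: KonnoKonno2007, §3.1 (3.1)] [cite: Folland1989, §4.2 Prop. (4.39)] [cite: Shimura1997, §6.5] -/
theorem fr_mem_kV_range (hdV0 : ∀ i, dV i ≠ 0) (hdW0 : ∀ j, dW j ≠ 0)
    (fr : ∀ w : {w : InfinitePlace L // w.IsComplex}, Matrix.unitaryGroup (Fin n) ℂ →* archLocal L (n + n) (hermD L e dV hdV dW hdW) w)
    (hfrM : ∀ (w : {w : InfinitePlace L // w.IsComplex}) (u : Matrix.unitaryGroup (Fin n) ℂ),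
      ((((fr w u : archLocal L (n + n) (hermD L e dV hdV dW hdW) w) : GL (Fin (n + n)) ℂ)) : Matrix (Fin (n + n)) (Fin (n + n)) ℂ) =
        Matrix.reindex (e₂ (n := n)) (e₂ (n := n))
          (fromBlocks (diagonal (fun k => (((Real.sqrt (|(w.1.embedding (dV (e.symm k).1 * dW (e.symm k).2)).re| / 2))⁻¹ / 2 : ℝ) : ℂ)))
              (-diagonal (fun k => I * (((Real.sqrt (|(w.1.embedding (dV (e.symm k).1 * dW (e.symm k).2)).re| / 2))⁻¹ *
                ((w.1.embedding (dV (e.symm k).1 * dW (e.symm k).2)).re / |(w.1.embedding (dV (e.symm k).1 * dW (e.symm k).2)).re|) / 2 : ℝ) : ℂ)))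
              (diagonal (fun k => (((Real.sqrt (|(w.1.embedding (dV (e.symm k).1 * dW (e.symm k).2)).re| / 2))⁻¹ / 2 : ℝ) : ℂ)))
              (diagonal (fun k => I * (((Real.sqrt (|(w.1.embedding (dV (e.symm k).1 * dW (e.symm k).2)).re| / 2))⁻¹ *
                ((w.1.embedding (dV (e.symm k).1 * dW (e.symm k).2)).re / |(w.1.embedding (dV (e.symm k).1 * dW (e.symm k).2)).re|) / 2 : ℝ) : ℂ))) *
            ((fromBlocks 1 1 (I • 1) (-(I • 1)) : Matrix (Fin n ⊕ Fin n) (Fin n ⊕ Fin n) ℂ) * fromBlocks 1 0 0 (u : Matrix (Fin n) (Fin n) ℂ) *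
              ((2 : ℂ)⁻¹ • fromBlocks 1 (-(I • 1)) 1 (I • 1))) *
            fromBlocks (diagonal (fun k => (Real.sqrt (|(w.1.embedding (dV (e.symm k).1 * dW (e.symm k).2)).re| / 2) : ℂ)))
              (diagonal (fun k => (Real.sqrt (|(w.1.embedding (dV (e.symm k).1 * dW (e.symm k).2)).re| / 2) : ℂ)))
              (diagonal (fun k => I * ((((w.1.embedding (dV (e.symm k).1 * dW (e.symm k).2)).re / |(w.1.embedding (dV (e.symm k).1 * dW (e.symm k).2)).re|) *
                Real.sqrt (|(w.1.embedding (dV (e.symm k).1 * dW (e.symm k).2)).re| / 2) : ℝ) : ℂ)))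
              (-diagonal (fun k => I * ((((w.1.embedding (dV (e.symm k).1 * dW (e.symm k).2)).re / |(w.1.embedding (dV (e.symm k).1 * dW (e.symm k).2)).re|) *
                Real.sqrt (|(w.1.embedding (dV (e.symm k).1 * dW (e.symm k).2)).re| / 2) : ℝ) : ℂ)))))
    (w : {w : InfinitePlace L // w.IsComplex}) (u : Matrix.unitaryGroup (Fin n) ℂ) (σ : {v : InfinitePlace (Fp L) // v.IsReal}) :
    archUFormPi L (IsCMField.complexConj L) (n + n) (IsCMField.complexConj_ne_one L) (cmPlaceOver L) (cmPlaceOver_smul L) (cmPlaceOver_comap L) _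
          (gramD_gram_realDiagonal_entry_ne_zero L e dV hdV dW hdW hdV0 hdW0) (gramD_eq_diagonal_cm L e dV hdV dW hdW) (J := hermD L e dV hdV dW hdW) rfl
          (complexConj_imagUnit L) (imagUnit_ne_zero L)
          ((archPiEquivCM (n + n) L (hermD L e dV hdV dW hdW)).symm (Pi.mulSingle w (fr w u))) σ ∈
      (UForm.kV (PosIdx (signVec (cmPlaceOver L)
        (fun k => Sum.elim (cmGramEntry L e dV hdV dW hdW) (-cmGramEntry L e dV hdV dW hdW) ((UnitaryDualPair.LocalSplitting.e₂ n).symm k)) (imagUnit L) σ))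
        (NegIdx (signVec (cmPlaceOver L)
        (fun k => Sum.elim (cmGramEntry L e dV hdV dW hdW) (-cmGramEntry L e dV hdV dW hdW) ((UnitaryDualPair.LocalSplitting.e₂ n).symm k)) (imagUnit L) σ))).range := by
  rw [mulSingle_frameHom (fun w' => fr w') w u]
  exact fr_tuple_mem_kV_range L e dV hdV dW hdW hdV0 hdW0 fr hfrM (Pi.mulSingle w u) σ

end Summit.HodgeConjecture.HodgeConjecture.Cruxes.HLiu418.K2LiuArchReadingFrameKdiag

end
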